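import Literature.Computability.QuantumComplexity.EncodedCompilation
import Literature.Computability.QuantumComplexity.CompilerCodeFP
import HarnessLib

/-!
# The reduction's expansion and implementation on plain numerals

Topic `Literature/Computability/QuantumComplexity`. String-level layer of the
`PromiseBQP`-hardness of the Jones polynomial (Aharonov–Arad 2011, Thm. 3.1): the typed objects
of the matrix-level proof — primitive operations `PrimOp n` with `Fin n` wires
(`SignGateExpansion.lean`), crossings `Gen n = Fin (4n-1) × Bool` (`EncodedPrimitives.lean`) —
are mirrored by NUMERAL RECORDS, on which the reduction machine computes:

* `PrimRec = ℕ × ℕ × ℕ` (`(kind, wire, phase)`, kinds `0 = H`, `1 = Z`, `2 = CP`; phases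
  `0, 1, 2 = -1, i, -i`) and `PrimOp.toRec`; `adjSwapRecs`, `chainRecs`, `cpRecsLt`, `cpRecs`,
  `expandRec sym wires`, `expandGateRec`, `expandGatesRec` with the agreement theorems
  `map_toRec_adjSwapOps`, …, **`map_toRec_expandGates`**;
* `letterGensNat`, `wordGensNat`, `gadgetGensNat`, `implRec` (the implementation of a record
  from the five compiled words) with **`map_val_implOf`**, and `reductionWordNat` with
  **`map_val_reductionBraid`**: the braid of the reduction, as numeral crossings, is computed from
  the numeral records.

## References

* D. Aharonov, I. Arad, New J. Phys. 13 (2011) 035019, Thm. 3.1, §3 [AharonovArad2011].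
-/

noncomputable section

namespace Literature.Computability.QuantumComplexity

open Cryptography ExactCompiler

variable {n : ℕ}

/-! ### Records of primitives -/

/-- A primitive as numerals: `(kind, wire, phase)`. [folklore] -/
abbrev PrimRec : Type := ℕ × ℕ × ℕ

/-- The numeral of a phase. [folklore] -/
def PhaseK.toNat : PhaseK → ℕ
  | PhaseK.neg => 0
  | PhaseK.posI => 1
  | PhaseK.negI => 2

/-- The record of a primitive. [folklore] -/
def PrimOp.toRec : PrimOp n → PrimRec
  | PrimOp.had a => (0, a, 0)
  | PrimOp.zed a => (1, a, 0)
  | PrimOp.cp a _ u => (2, a, u.toNat)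

/-- The records of an adjacent swap. [folklore] -/
def adjSwapRecs (b : ℕ) : List PrimRec :=
  [(0, b + 1, 0), (2, b, 0), (0, b + 1, 0), (0, b, 0), (2, b, 0), (0, b, 0), (0, b + 1, 0), (2, b, 0), (0, b + 1, 0)]

/-- Agreement on adjacent swaps. [folklore] -/
theorem map_toRec_adjSwapOps (b : ℕ) (hb : b + 2 ≤ n) : (adjSwapOps b hb).map PrimOp.toRec = adjSwapRecs b := rfl

/-- The records of a chain. [folklore] -/
def chainRecs (lo : ℕ) : ℕ → List PrimRec
  | 0 => []
  | d + 1 => chainRecs lo d ++ adjSwapRecs (lo + 1 + d)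

/-- Agreement on chains. [folklore] -/
theorem map_toRec_chainOps (lo : ℕ) : ∀ (d : ℕ) (h : lo + 2 + d ≤ n), (chainOps lo d h).map PrimOp.toRec = chainRecs lo d
  | 0, _ => rfl
  | d + 1, h => by rw [chainOps, chainRecs, List.map_append, map_toRec_chainOps lo d, map_toRec_adjSwapOps]

/-- The records of a controlled phase on wires `i < j`. [folklore] -/
def cpRecsLt (i j u : ℕ) : List PrimRec := (chainRecs i (j - i - 1)).reverse ++ [(2, i, u)] ++ chainRecs i (j - i - 1)

/-- Agreement on `cpOpsLt`. [folklore] -/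
theorem map_toRec_cpOpsLt (i j : ℕ) (hij : i < j) (hj : j < n) (u : PhaseK) : (cpOpsLt (n := n) i j hij hj u).map PrimOp.toRec = cpRecsLt i j u.toNat := by
  rw [cpOpsLt, cpRecsLt, List.map_append, List.map_append, List.map_reverse, map_toRec_chainOps]; rfl

/-- The records of a controlled phase on wires `i ≠ j`. [folklore] -/
def cpRecs (i j u : ℕ) : List PrimRec := if i < j then cpRecsLt i j u else cpRecsLt j i u

/-- Agreement on `cpOps`. [folklore] -/
theorem map_toRec_cpOps (i j : Fin n) (h : i ≠ j) (u : PhaseK) : (cpOps i j h u).map PrimOp.toRec = cpRecs i j u.toNat := by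
  unfold cpOps cpRecs
  split_ifs with hlt <;> exact map_toRec_cpOpsLt _ _ _ _ _

/-- **The records of the expansion of a gate**, from its symbol numeral (`0 = H`, `1 = Z`, `2 = CZ`,
`3 = CCZ`) and its wire list. [cite: AharonovArad2011, §3.2] -/
def expandRec (sym : ℕ) (ws : List ℕ) : List PrimRec :=
  if sym = 0 then [(0, ws.getD 0 0, 0)]
  else if sym = 1 then [(1, ws.getD 0 0, 0)]
  else if sym = 2 then cpRecs (ws.getD 0 0) (ws.getD 1 0) 0
  else cpRecs (ws.getD 1 0) (ws.getD 2 0) 1 ++ ([(0, ws.getD 1 0, 0)] ++ cpRecs (ws.getD 0 0) (ws.getD 1 0) 0 ++ [(0, ws.getD 1 0, 0)]) ++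
    cpRecs (ws.getD 1 0) (ws.getD 2 0) 2 ++ ([(0, ws.getD 1 0, 0)] ++ cpRecs (ws.getD 0 0) (ws.getD 1 0) 0 ++ [(0, ws.getD 1 0, 0)]) ++
    cpRecs (ws.getD 0 0) (ws.getD 2 0) 1

/-- The symbol numeral of a gate of the sign basis. [folklore] -/
theorem encode_hSignOp (g : HSignOp) : Encodable.encode g = (match g with | HSignOp.H => 0 | HSignOp.Z => 1 | HSignOp.CZ => 2 | HSignOp.CCZ => 3 : ℕ) := by
  cases g <;> rfl

/-- The wire list of a placed gate. [folklore] -/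
def wiresOf {k : ℕ} (e : Fin k ↪ Fin n) : List ℕ := List.ofFn fun i => (e i : ℕ)

/-- Entries of the wire list. [folklore] -/
theorem wiresOf_getD {k : ℕ} (e : Fin k ↪ Fin n) (i : ℕ) (hi : i < k) : (wiresOf e).getD i 0 = e ⟨i, hi⟩ := by
  rw [wiresOf, List.getD_eq_getElem?_getD, List.getElem?_ofFn]
  simp [hi]

/-- Agreement on `H`. [folklore] -/
theorem map_toRec_expandGate_H (e : Fin 1 ↪ Fin n) :
    (expandGate (QGate.gate HSignOp.H e)).map PrimOp.toRec = expandRec (Encodable.encode HSignOp.H) (wiresOf e) := by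
  change [PrimOp.toRec (PrimOp.had (e 0))] = expandRec (Encodable.encode HSignOp.H) (wiresOf e)
  rw [encode_hSignOp]; simp only [expandRec, if_true]
  rw [wiresOf_getD e 0 Nat.one_pos]; rfl

/-- Agreement on `Z`. [folklore] -/
theorem map_toRec_expandGate_Z (e : Fin 1 ↪ Fin n) :
    (expandGate (QGate.gate HSignOp.Z e)).map PrimOp.toRec = expandRec (Encodable.encode HSignOp.Z) (wiresOf e) := by
  change [PrimOp.toRec (PrimOp.zed (e 0))] = expandRec (Encodable.encode HSignOp.Z) (wiresOf e)
  rw [encode_hSignOp]; simp only [expandRec, one_ne_zero, if_false, if_true]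
  rw [wiresOf_getD e 0 Nat.one_pos]; rfl

/-- Agreement on `CZ`. [folklore] -/
theorem map_toRec_expandGate_CZ (e : Fin 2 ↪ Fin n) :
    (expandGate (QGate.gate HSignOp.CZ e)).map PrimOp.toRec = expandRec (Encodable.encode HSignOp.CZ) (wiresOf e) := by
  have h01 : e 0 ≠ e 1 := fun h => by have := e.injective h; simp at this
  change (cpOps (e 0) (e 1) h01 PhaseK.neg).map PrimOp.toRec = expandRec (Encodable.encode HSignOp.CZ) (wiresOf e)
  rw [encode_hSignOp]; simp only [expandRec, show (2:ℕ) ≠ 0 by decide, show (2:ℕ) ≠ 1 by decide, if_false, if_true]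
  rw [map_toRec_cpOps, wiresOf_getD e 0 (by norm_num), wiresOf_getD e 1 (by norm_num)]; rfl

/-- Agreement on `CCZ`. [folklore] -/
theorem map_toRec_expandGate_CCZ (e : Fin 3 ↪ Fin n) :
    (expandGate (QGate.gate HSignOp.CCZ e)).map PrimOp.toRec = expandRec (Encodable.encode HSignOp.CCZ) (wiresOf e) := by
  have h01 : e 0 ≠ e 1 := fun h => by have := e.injective h; simp at this
  have h02 : e 0 ≠ e 2 := fun h => by have := e.injective h; simp at this
  have h12 : e 1 ≠ e 2 := fun h => by have := e.injective h; simp at this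
  change (cpOps (e 1) (e 2) h12 PhaseK.posI ++ ([PrimOp.had (e 1)] ++ cpOps (e 0) (e 1) h01 PhaseK.neg ++ [PrimOp.had (e 1)]) ++
      cpOps (e 1) (e 2) h12 PhaseK.negI ++ ([PrimOp.had (e 1)] ++ cpOps (e 0) (e 1) h01 PhaseK.neg ++ [PrimOp.had (e 1)]) ++
      cpOps (e 0) (e 2) h02 PhaseK.posI).map PrimOp.toRec = expandRec (Encodable.encode HSignOp.CCZ) (wiresOf e)
  rw [encode_hSignOp]
  simp only [expandRec, show (3:ℕ) ≠ 0 by decide, show (3:ℕ) ≠ 1 by decide, show (3:ℕ) ≠ 2 by decide, if_false, List.map_append,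
    List.map_cons, List.map_nil, map_toRec_cpOps]
  rw [wiresOf_getD e 0 (by norm_num), wiresOf_getD e 1 (by norm_num), wiresOf_getD e 2 (by norm_num)]
  rfl

/-- **Agreement of the expansion of a gate.** [cite: AharonovArad2011, §3.2] -/
theorem map_toRec_expandGate (g : HSignOp) (e : Fin (hSign.arity g) ↪ Fin n) :
    (expandGate (QGate.gate g e)).map PrimOp.toRec = expandRec (Encodable.encode g) (wiresOf e) := by
  cases g with
  | H => exact map_toRec_expandGate_H e
  | Z => exact map_toRec_expandGate_Z e
  | CZ => exact map_toRec_expandGate_CZ e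
  | CCZ => exact map_toRec_expandGate_CCZ e

/-- **The record list of a gate** (oracle gates expand to nothing). [folklore] -/
def expandGateRec : QGate hSign n → List PrimRec
  | QGate.gate g e => expandRec (Encodable.encode g) (wiresOf e)
  | QGate.oracle _ _ => []

/-- Agreement on gates. [folklore] -/
theorem map_toRec_expandGate' (g : QGate hSign n) : (expandGate g).map PrimOp.toRec = expandGateRec g := by
  rcases g with ⟨g, e⟩ | ⟨m, e⟩
  · exact map_toRec_expandGate g e
  · rfl

/-- The record list of a gate list. [folklore] -/
def expandGatesRec (gs : List (QGate hSign n)) : List PrimRec := (gs.reverse.map expandGateRec).flatten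

/-- **Agreement of the expansion of a circuit.** [cite: AharonovArad2011, §3.2] -/
theorem map_toRec_expandGates (gs : List (QGate hSign n)) : (expandGates gs).map PrimOp.toRec = expandGatesRec gs := by
  rw [expandGates, expandGatesRec, List.map_flatten, List.map_map]
  congr 1
  exact List.map_congr_left fun g _ => map_toRec_expandGate' g

/-- The expansion has as many records as primitives. [folklore] -/
theorem length_expandGatesRec (gs : List (QGate hSign n)) : (expandGatesRec gs).length = (expandGates gs).length := by
  rw [← map_toRec_expandGates, List.length_map]

/-! ### Records of crossings -/

/-- The crossings of a letter on block `a`, as numerals. [folklore] -/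
def letterGensNat (a : ℕ) : Letter → List (ℕ × Bool)
  | Letter.x => [(4 * a + 0, true), (4 * a + 1, false)]
  | Letter.y => [(4 * a + 0, false), (4 * a + 1, true)]
  | Letter.xi => [(4 * a + 1, true), (4 * a + 0, false)]
  | Letter.yi => [(4 * a + 1, false), (4 * a + 0, true)]

/-- The crossings of a word on block `a`, as numerals. [folklore] -/
def wordGensNat (a : ℕ) (w : List Letter) : List (ℕ × Bool) := w.flatMap (letterGensNat a)

/-- Agreement for letters. [folklore] -/
theorem map_val_letterGens₁ (a : Fin n) (γ : Letter) : (letterGens₁ a γ).map (fun g => ((g.1 : ℕ), g.2)) = letterGensNat a γ := by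
  cases γ <;> rfl

/-- Agreement for words. [folklore] -/
theorem map_val_wordGens₁ (a : Fin n) (w : List Letter) : (wordGens₁ a w).map (fun g => ((g.1 : ℕ), g.2)) = wordGensNat a w := by
  rw [wordGens₁, wordGensNat, List.map_flatMap]
  exact flatMap_congr_mem fun γ _ => map_val_letterGens₁ a γ

/-- The crossings of a gadget word on the window at block `a`, as numerals. [folklore] -/
def gadgetGensNat (a : ℕ) (g : List Gadget.Sym) : List (ℕ × Bool) := (Gadget.expand g).reverse.map fun l => (4 * a + (l.1 : ℕ), l.2)

/-- Agreement for gadget words. [folklore] -/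
theorem map_val_gadgetGens (a : ℕ) (ha : a + 2 ≤ n) (g : List Gadget.Sym) :
    (gadgetGens a ha g).map (fun g => ((g.1 : ℕ), g.2)) = gadgetGensNat a g := by
  rw [gadgetGens, gadgetGensNat, List.map_map, List.map_map]; rfl

/-- **The implementation of a record** from the five compiled words `wH, wZ, wCZ, wCS, wCS†`. [cite: AharonovArad2011, §3.3] -/
def implRec (wH wZ wCZ wCS wCSd : List Letter) (r : PrimRec) : List (ℕ × Bool) :=
  if r.1 = 0 then wordGensNat r.2.1 wH
  else if r.1 = 1 then wordGensNat r.2.1 wZ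
  else if r.2.2 = 0 then gadgetGensNat r.2.1 (symsOfWord wCZ)
  else if r.2.2 = 1 then gadgetGensNat r.2.1 (symsOfWord wCS)
  else gadgetGensNat r.2.1 (symsOfWord wCSd)

/-- **Agreement of the implementation of a primitive.** [cite: AharonovArad2011, §3.3] -/
theorem map_val_implOf (P : CompilerParams) (L : ℕ) (p : PrimOp n) :
    (implOf P L p).map (fun g => ((g.1 : ℕ), g.2)) =
      implRec (word₁ P scoreH L) (word₁ P scoreZ L) (word₂ P scoreCZ L) (word₂ P scoreZ L) (word₂ P scoreZ' L) p.toRec := by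
  cases p with
  | had a => rw [implOf, map_val_wordGens₁]; rfl
  | zed a => rw [implOf, map_val_wordGens₁]; rfl
  | cp a ha u =>
    cases u
    · rw [implOf, map_val_gadgetGens]; rfl
    · rw [implOf, map_val_gadgetGens]; rfl
    · rw [implOf, map_val_gadgetGens]; rfl

/-- **The braid word of the reduction, as numerals.** [cite: AharonovArad2011, Thm. 3.1] -/
noncomputable def reductionWordNat (P : CompilerParams) (gs : List (QGate hSign n)) : List (ℕ × Bool) :=
  let L := lOf (expandGatesRec gs).length
  (expandGatesRec gs).flatMap (implRec (word₁ P scoreH L) (word₁ P scoreZ L) (word₂ P scoreCZ L) (word₂ P scoreZ L) (word₂ P scoreZ' L))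

/-- **Agreement of the braid word of the reduction.** [cite: AharonovArad2011, Thm. 3.1] -/
theorem map_val_reductionBraid (P : CompilerParams) (gs : List (QGate hSign n)) :
    (reductionBraid P gs).map (fun g => ((g.1 : ℕ), g.2)) = reductionWordNat P gs := by
  rw [reductionBraid, reductionWordNat, implOps, List.map_flatMap, length_expandGatesRec, ← map_toRec_expandGates, List.flatMap_map]
  exact flatMap_congr_mem fun p _ => map_val_implOf P _ p

end Literature.Computability.QuantumComplexity

end
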